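import Summits.KontsevichZagierPeriods.Zeta5Search.WedgeDictionaryMixedRelation
import HarnessLib

/-!
# Cross-contiguity of the three slot-7 wedges in the slots (2,7) — (L2) of the level-descent proof, PROVED

HONEST FRAMING: systematic search; no irrationality claim unless certified.

OUR work (Summit side; planner gen-1 g7, 2026-08-20; memo `pub-zeta5-gen-1/D2-LD-PROOF-g7.md` §2).  For the wedges `C ∈ {casUW, casUV, casVW}`
(`casUW` defined here; `casUV`, `casVW` from `WedgeDictionaryCoeffV`) and `b` with `MixedHyp b` (`WedgeDictionaryMixedRelation`):

  `(b₂−b₇)(d+1)·C(b) = b₂Π₂·C(b−e₂) − b₇Π₇·C(b−e₇)`   (`crossContiguity`, PROVED as `crossContiguity_holds`).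

PROOF: `X(b)·(L1)[Y] − Y(b)·(L1)[X]` (`mixedRelation_holds`) kills the `δ(b)` term; the slot-2 wedge at the base `b − e₂` that appears equals the
slot-7 wedge there by the j-freeness `coeff_update_sub` (`dOf (b−e₂) = d+1 ≥ 0`) — `crossRel_of_mixedRel`.  This is the relation that the level-descent
weights satisfy termwise ((L3), `WedgeDictionaryLevelDescentWeightsProof.ldW_cross`).  What this is NOT: anything about irrationality; an identity
between rational numbers.
-/

open Finset

namespace Summit.KontsevichZagierPeriods.Zeta5Search.WedgeDictionary

open Summit.KontsevichZagierPeriods.Zeta5Search.DualSeries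

/-- The `U ∧ W` wedge in slot 7 (cf. `casUV`, `casVW`). -/
noncomputable def casUW (b : ℕ → ℤ) : ℚ := coeffU b * coeffW (bump b 6) - coeffU (bump b 6) * coeffW b

/-- The cross-contiguity relation for a wedge functional `Cw`:
`(b₂−b₇)(d+1)·Cw(b) = b₂Π₂·Cw(b−e₂) − b₇Π₇·Cw(b−e₇)`. -/
def CrossRel (Cw : (ℕ → ℤ) → ℚ) (b : ℕ → ℤ) : Prop :=
  ((b 2 : ℚ) - b 7) * ((dOf b : ℚ) + 1) * Cw b =
    (b 2 : ℚ) * mixedPi2 b * Cw (lowerSlot b 2) - (b 7 : ℚ) * mixedPi7 b * Cw (lowerSlot b 7)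

/-- **(L2) (memo §2; INTERNALLY MINTED, now PROVED below as `crossContiguity_holds`): cross-contiguity of the three slot-7 wedges in the slots (2,7).** -/
@[conjecture] def crossContiguity : Prop :=
  ∀ b : ℕ → ℤ, MixedHyp b → CrossRel casUW b ∧ CrossRel casUV b ∧ CrossRel casVW b

/-- `(b − e₇) + e₇ = b`. -/
theorem bump_lowerSlot7 (b : ℕ → ℤ) : bump (lowerSlot b 7) 6 = b := by
  funext s
  by_cases h7 : s = 7
  · subst h7; simp [bump, lowerSlot]
  · simp [bump, lowerSlot, h7]

/-- (L2) from (L1), the algebraic core: if `X`, `Y` both satisfy the mixed relation at `b` and the slot-2 wedge at `b − e₂` equals the slot-7 wedge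
there (`hfree`), then the slot-7 wedge is cross-contiguous at `b`. -/
theorem crossRel_of_mixedRel (X Y : (ℕ → ℤ) → ℚ) (b : ℕ → ℤ) (hX : MixedRel X b) (hY : MixedRel Y b)
    (hfree : X (lowerSlot b 2) * Y b - X b * Y (lowerSlot b 2) =
      X (lowerSlot b 2) * Y (bump (lowerSlot b 2) 6) - X (bump (lowerSlot b 2) 6) * Y (lowerSlot b 2))
    (h7 : bump (lowerSlot b 7) 6 = b) :
    CrossRel (fun a => X a * Y (bump a 6) - X (bump a 6) * Y a) b := by
  unfold CrossRel
  unfold MixedRel at hX hY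
  simp only [h7]
  linear_combination (X b) * hY - (Y b) * hX + (b 2 : ℚ) * mixedPi2 b * hfree

/-- The j-freeness of a wedge, abstract form: if `X`, `Y` have the same difference quotient between the slots `i` and `k` at `a`
(`coeff_update_sub`), the slot-`i` and slot-`k` wedges of `X ∧ Y` at `a` agree. -/
theorem wedge_free (X Y : (ℕ → ℤ) → ℚ) (a : ℕ → ℤ) (i k : ℕ) (lam : ℚ)
    (hX : X (Function.update a i (a i + 1)) - X (Function.update a k (a k + 1)) = lam * X a)
    (hY : Y (Function.update a i (a i + 1)) - Y (Function.update a k (a k + 1)) = lam * Y a) :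
    X a * Y (Function.update a i (a i + 1)) - X (Function.update a i (a i + 1)) * Y a =
      X a * Y (Function.update a k (a k + 1)) - X (Function.update a k (a k + 1)) * Y a := by
  linear_combination (X a) * hY - (Y a) * hX

/-- STATEMENT (j-freeness of the level-descent left-hand sides; PROVED below as `wedgeSlotFree_holds`): for `b` in the box with `d ≥ 0`,
`b_j ≤ N`, `b₇ ≤ N`, the slot-`j` wedges of `levelDescentW` / `levelDescentV` (`j = 1..7`) are the slot-7 wedges `casUW b` / `casUV b`. -/
def wedgeSlotFree : Prop :=
  ∀ (b : ℕ → ℤ) (j : ℕ), j ∈ Icc 1 7 → InBox b → 0 ≤ dOf b → b j ≤ b 0 → b 7 ≤ b 0 →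
    coeffU b * coeffW (Function.update b j (b j + 1)) - coeffU (Function.update b j (b j + 1)) * coeffW b = casUW b ∧
      coeffU b * coeffV (Function.update b j (b j + 1)) - coeffU (Function.update b j (b j + 1)) * coeffV b = casUV b

/-- **j-freeness of the level-descent left-hand sides**: for `b` in the box with `d ≥ 0`, `b_j ≤ N`, `b₇ ≤ N`, the slot-`j` wedges
`U(b)W(b+e_j) − U(b+e_j)W(b)` and `U(b)V(b+e_j) − U(b+e_j)V(b)` (`j = 1..7`, as in `levelDescentW`/`levelDescentV`) are the slot-7 wedges `casUW b`, `casUV b`. -/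
theorem wedge_slot_free (b : ℕ → ℤ) (hb : InBox b) (hd : 0 ≤ dOf b) {j : ℕ} (hj : j ∈ Icc 1 7) (hjN : b j ≤ b 0) (h7N : b 7 ≤ b 0) :
    coeffU b * coeffW (Function.update b j (b j + 1)) - coeffU (Function.update b j (b j + 1)) * coeffW b = casUW b ∧
      coeffU b * coeffV (Function.update b j (b j + 1)) - coeffU (Function.update b j (b j + 1)) * coeffV b = casUV b := by
  have hj' := mem_Icc.1 hj
  have hi : j - 1 ∈ range 7 := by simp only [mem_range]; omega
  have hjj : j - 1 + 1 = j := by omega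
  have S := coeff_update_sub b hb hd hi (k := 6) (by simp) (by rw [hjj]; exact hjN) (by simpa using h7N)
  rw [hjj] at S
  simp only [Nat.reduceAdd] at S
  obtain ⟨SU, SW, SV⟩ := S
  have e7 : Function.update b 7 (b 7 + 1) = bump b 6 := by simp only [bump, Nat.reduceAdd]
  refine ⟨?_, ?_⟩
  · have := wedge_free coeffU coeffW b j 7 _ SU SW
    rw [e7] at this; simpa [casUW] using this
  · have := wedge_free coeffU coeffV b j 7 _ SU SV
    rw [e7] at this; simpa [casUV] using this

/-- `wedgeSlotFree` holds. -/
theorem wedgeSlotFree_holds : wedgeSlotFree := fun b _ hj hb hd hjN h7N => wedge_slot_free b hb hd hj hjN h7N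

/-- **(L2) PROVED.** Cross-contiguity of `casUW`, `casUV`, `casVW` in the slots (2,7) under `MixedHyp`. -/
theorem crossContiguity_holds : crossContiguity := by
  intro b hyp
  obtain ⟨hU, hW, hV⟩ := mixedRelation_holds b hyp
  obtain ⟨hb, hd, hb2, hb7, h27, hle⟩ := hyp
  obtain ⟨h0, h1, h2, h3, h4, h5, h6, h7⟩ := (inBox_iff b).1 hb
  simp only [Icc_one_seven, mem_insert, mem_singleton, forall_eq_or_imp, forall_eq] at hle
  obtain ⟨hl1, hl2, hl3, hl4, hl5, hl6, hl7⟩ := hle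
  have hL2 : InBox (lowerSlot b 2) := by
    rw [inBox_iff]; simp only [lowerSlot2_apply]; simp; omega
  have hdL2 : 0 ≤ dOf (lowerSlot b 2) := by rw [dOf_lowerSlot2]; omega
  have S := coeff_update_sub (lowerSlot b 2) hL2 hdL2 (i := 1) (k := 6) (by simp) (by simp)
    (by simp only [Nat.reduceAdd, lowerSlot2_apply]; simp; omega) (by simp only [Nat.reduceAdd, lowerSlot2_apply]; simp; omega)
  simp only [Nat.reduceAdd] at S
  obtain ⟨SU, SW, SV⟩ := S
  have e2 := update2_lowerSlot2 b
  have e7 := update7_lowerSlot2 b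
  have hB := bump_lowerSlot7 b
  have fUW := wedge_free coeffU coeffW (lowerSlot b 2) 2 7 _ SU SW
  have fUV := wedge_free coeffU coeffV (lowerSlot b 2) 2 7 _ SU SV
  have fVW := wedge_free coeffV coeffW (lowerSlot b 2) 2 7 _ SV SW
  rw [e2, e7] at fUW fUV fVW
  refine ⟨?_, ?_, ?_⟩
  · have := crossRel_of_mixedRel coeffU coeffW b hU hW (by linear_combination fUW) hB
    simpa [CrossRel, casUW] using this
  · have := crossRel_of_mixedRel coeffU coeffV b hU hV (by linear_combination fUV) hB
    simpa [CrossRel, casUV] using this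
  · have := crossRel_of_mixedRel coeffV coeffW b hV hW (by linear_combination fVW) hB
    simpa [CrossRel, casVW] using this

end Summit.KontsevichZagierPeriods.Zeta5Search.WedgeDictionary
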